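import Summits.BirchSwinnertonDyer.BirchSwinnertonDyer.Theses.RamifiedSevenEllipticUnits
import Summits.BirchSwinnertonDyer.Rank1Residual.X11b.AnticyclotomicInfinitePlaces
import Summits.BirchSwinnertonDyer.Rank1Residual.X11b.AnticyclotomicGoodPlaces
import Summits.BirchSwinnertonDyer.Rank1Residual.X11b.AnticyclotomicLocalKernelTrivial
import Summits.BirchSwinnertonDyer.Rank1Residual.X11b.AnticyclotomicControlCount
import Summits.BirchSwinnertonDyer.Rank1Residual.X11b.BDPRouteLocalKernelBound
import HarnessLib

set_option linter.dupNamespace false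
set_option autoImplicit false

/-!
# Route `RamifiedSevenEllipticUnits` (rung K7r), crux `StrictControlSeven` (stmt-BirchSwinnertonDyer-19145):
# EXACT CONTROL `Sel_𝔭(K, E[p^∞]) ≅ Sel_𝔭(K_∞, E[p^∞])^Γ` at a prime of ADDITIVE reduction from two
# local no-`p`-torsion statements (memo O11-RAMIFIED-DESCENT §3 Step 2, in the kernel modulo (3.16))

Cell `bsd-cm`, seat `bsd-cm-k7r-c4` (g0). HONEST FRAMING: nothing here closes the crux; BSD is not
proved by any of this. The local input "`E(K_𝔭)[7] = 0`" (BKNO (3.16)) stays a displayed hypothesis.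

## What is proved

For an elliptic curve `E` over a TOTALLY COMPLEX number field `K` (e.g. `K` imaginary quadratic), a
prime `p`, ANY `ℤ_p`-extension `κ` of `K` with topological generator `γ` and ANY finite place `𝔭`
(intended: the unique, ramified prime above `p` of the CM field), Castella's control map
`s : Sel_𝔭(K, E[p^∞]) → Sel_𝔭(K_∞, E[p^∞])^γ` (`X11b.AcSelmer.controlMap`, `Σ = ∅`: strict at `𝔭`,
relaxed at the other primes above `p`, locally trivial off `p`) is BIJECTIVE as soon as

* `E(K_𝔭)[p] = 0` (no `K_𝔭`-point of order `p`; for `E ∈ 𝒞₇` at `p = 7` this is BKNO (3.16)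
  `H⁰(K^ac_{∞,𝔭}, E[7^∞]) = 0` read at the bottom — pro-`p` descent does the rest), and
* at every finite `v ∤ p`: `E` has good reduction at `v` OR `E(K_v)[p] = 0` (for CM curves every bad
  `v` is additive, where `E(K_v)[p] = 0` for `p ≥ 5`, `v ∤ p` — memo (LV1)–(LV3)),

— `controlMap_bijective_of_noPTorsion` — and then
**`#H⁰(Γ, Sel_𝔭(K_∞, E[p^∞])) = #Sel_𝔭(K, E[p^∞])`** (`natCard_endInvariants_eq_natCard_selmerAcBase_of_noPTorsion`).
Everything is an instantiation of the sibling cell's landed control machinery on the CONSTRUCTED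
objects: Greenberg's Lemma 3.1 (`resSubgroup_kerSubgroup_injective_of_fixedPoints_eq_bot`), Lemma 3.2
(inside `controlMap_bijective_of_away_descent`), strict descent at `𝔭`
(`fixedPoints_decomp_inf_kerSubgroup_eq_bot` + `eq_zero_of_fixed_decomp_of_local`), Lemma 3.3 at the
good places (`resOfLe_mem_awayKer_kerSubgroup_iff_of_hasGoodReductionAt`), `ker r_v = 0` from
`E(K_v)[p] = 0` (`localKer_eq_bot_of_noPTorsion`, `mem_awayKer_of_localKer_eq_bot`), the infinite
places of a totally complex field (`infConditions_descend_of_isTotallyComplex`).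

`strictControl_frame_natCard_eq`: the same at an O11 frame `(K, 𝔭, W', C)` of `(W, p)` (the frame's
`K` is imaginary quadratic, hence totally complex). Combined with the seat's companion file
`RamifiedSevenEllipticUnitsStrictControlEulerChar` ((R-ctrl) ⟺ the `Λ`-free form (R-ctrl)♭:
`log_p #H⁰(Γ, Sel_𝔭(K_∞)) = log_p #Sel_str(W/ℚ)[p^∞] + log_p #Sel_str(W'/ℚ)[p^∞]`), crux #4 is thereby
reduced, modulo the two local no-`p`-torsion inputs, to the `K → ℚ` TWIST DESCENT identity
`log_p #Sel_𝔭(K, E[p^∞]) = log_p #Sel_str(W/ℚ)[p^∞] + log_p #Sel_str(W'/ℚ)[p^∞]` (memo Step 1).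

References: [GreenbergLNM1716] §3 Lemmas 3.1–3.3, Thm. 1.2 (pp. 85–90); [Castella2018] Def. 2.2,
Thm. 2.3 (arXiv:1704.06608 p. 5); [BurungaleKobayashiNakamuraOta2026] (3.16), Thm. 6.1
(arXiv:2608.06879; shape only, nothing used); [JetchevSkinnerWan2017] §3.3 (shape only).
-/

noncomputable section

open scoped Classical

open WeierstrassCurve NumberField IsDedekindDomain Field
  Literature.NumberTheory.EllipticCurves
  Literature.NumberTheory.EllipticCurves.GreenbergSelmer
  Literature.NumberTheory.EllipticCurves.Rank1Residual
  Literature.NumberTheory.GaloisRepresentations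
  Summit.BirchSwinnertonDyer.Rank1Residual
  Summit.BirchSwinnertonDyer.Rank1Residual.X11b
  Summit.BirchSwinnertonDyer.Rank1Residual.X11b.AcSelmer

namespace Summit.BirchSwinnertonDyer.BirchSwinnertonDyer.Theorems.RamifiedSevenEllipticUnits

/-! ## §1 Exact control from two local no-`p`-torsion statements (any `E/K`, `K` totally complex) -/

section Control

variable {K : Type} [Field K] [NumberField K] (E : WeierstrassCurve K) [E.IsElliptic]
  (p : ℕ) [Fact p.Prime] (κ : ZpExtension K p) (𝔭 : HeightOneSpectrum (𝓞 K))

/-- **`E(K_𝔭)[p] = 0 ⟹ E(K̄)[p^∞]^{D_𝔭 ⊓ ker κ} = 0`** (no `p^∞`-torsion over the completion of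
`K_∞` above `𝔭`): Galois descent to `E(K_𝔭)` (`eq_zero_of_fixed_decomp_of_local`) and pro-`p` descent
along `K_{∞,w}/K_𝔭` (`fixedPoints_decomp_inf_kerSubgroup_eq_bot`). For `E ∈ 𝒞₇`, `p = 7`, `𝔭 = (√−7)`
this is BKNO (3.16). [cite: GreenbergLNM1716, §3 pp. 74–75] [cite: BurungaleKobayashiNakamuraOta2026, (3.16) (arXiv:2608.06879; shape only)] -/
theorem fixedPoints_decomp_inf_kerSubgroup_eq_bot_of_noPTorsion
    (h𝔭 : ∀ R : (E.baseChange (𝔭.adicCompletion K)).toAffine.Point, p • R = 0 → R = 0) :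
    FixedPoints.addSubgroup ↥(decomp 𝔭 ⊓ κ.kerSubgroup) (E.geomPrimaryTorsion p) = ⊥ :=
  fixedPoints_decomp_inf_kerSubgroup_eq_bot κ E 𝔭
    (fun m hfix hpm ↦ eq_zero_of_fixed_decomp_of_local E p 𝔭 h𝔭 m hfix hpm)

/-- **`E(K_𝔭)[p] = 0 ⟹ E(K_∞)[p^∞] = 0`** (`E(K̄)[p^∞]^{ker κ} = 0`): a point fixed by `Gal(K̄/K_∞)`
is fixed by its decomposition subgroup at `𝔭`. [cite: GreenbergLNM1716, §3 Lemma 3.1 (p. 86)] -/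
theorem fixedPoints_kerSubgroup_eq_bot_of_noPTorsion
    (h𝔭 : ∀ R : (E.baseChange (𝔭.adicCompletion K)).toAffine.Point, p • R = 0 → R = 0) :
    FixedPoints.addSubgroup κ.kerSubgroup (E.geomPrimaryTorsion p) = ⊥ := by
  rw [eq_bot_iff]
  intro m hm
  rw [← fixedPoints_decomp_inf_kerSubgroup_eq_bot_of_noPTorsion E p κ 𝔭 h𝔭]
  exact fun g ↦ hm ⟨g, (Subgroup.mem_inf.mp g.2).2⟩

variable [IsTotallyComplex K] (γ : absoluteGaloisGroup K) [hγ : Fact (κ.IsTopGenerator γ)]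

/-- **EXACT CONTROL at `Σ = ∅` from two local no-`p`-torsion statements.** For `E/K` elliptic, `K`
totally complex, any `ℤ_p`-extension `κ` with topological generator `γ`, any finite place `𝔭`: if
`E(K_𝔭)[p] = 0` and, at every finite `v ∤ p`, `E` has good reduction or `E(K_v)[p] = 0`, then
`s : Sel_𝔭(K, E[p^∞]) → Sel_𝔭(K_∞, E[p^∞])^γ` is bijective. Injectivity: Lemma 3.1 with
`E(K_∞)[p^∞] = 0`; strict place: `E(K̄)[p^∞]^{D_𝔭 ⊓ ker κ} = 0`; away descent: Lemma 3.3 at the good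
places, `ker r_v = 0` from `E(K_v)[p] = 0` elsewhere; infinite places: `K_w = ℂ`; the lift: Lemma 3.2.
[cite: GreenbergLNM1716, §3 Lemmas 3.1–3.3 and p. 90 (Thm. 1.2)] [cite: Castella2018, Def. 2.2 and Thm. 2.3 (arXiv:1704.06608 p. 5) (shape only)] -/
theorem controlMap_bijective_of_noPTorsion
    (h𝔭 : ∀ R : (E.baseChange (𝔭.adicCompletion K)).toAffine.Point, p • R = 0 → R = 0)
    (hv : ∀ v : HeightOneSpectrum (𝓞 K), ((p : ℕ) : 𝓞 K) ∉ v.asIdeal →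
      E.HasGoodReductionAt v ∨
        ∀ R : (E.baseChange (v.adicCompletion K)).toAffine.Point, p • R = 0 → R = 0) :
    Function.Bijective (controlMap E p κ 𝔭 ∅ γ) := by
  refine controlMap_bijective_of_away_descent E p κ 𝔭 ∅ hγ.out
    (resSubgroup_kerSubgroup_injective_of_fixedPoints_eq_bot E p κ hγ.out
      (fixedPoints_kerSubgroup_eq_bot_of_noPTorsion E p κ 𝔭 h𝔭))
    (fixedPoints_decomp_inf_kerSubgroup_eq_bot_of_noPTorsion E p κ 𝔭 h𝔭) ?_
  intro c hc v hpv hvS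
  rcases hv v hpv with hgood | htors
  · have h1 := ((mem_selmerOver_iff _).mp hc).1 v hpv hvS 1
    rw [Literature.NumberTheory.EllipticCurves.conjH1_one_holds, AddMonoidHom.id_apply] at h1
    exact (resOfLe_mem_awayKer_kerSubgroup_iff_of_hasGoodReductionAt E p κ hpv hgood c).mp h1
  · exact mem_awayKer_of_localKer_eq_bot hpv hvS
      (AcSelmer.localKer_eq_bot_of_noPTorsion E p κ v htors) hc

/-- **`#H⁰(Γ, Sel_𝔭(K_∞, E[p^∞])) = #Sel_𝔭(K, E[p^∞])`** under the same two local statements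
(`Nat.card`; `0 = 0` if infinite). [cite: GreenbergLNM1716, §3 Thm. 1.2 and p. 90] -/
theorem natCard_endInvariants_eq_natCard_selmerAcBase_of_noPTorsion
    (h𝔭 : ∀ R : (E.baseChange (𝔭.adicCompletion K)).toAffine.Point, p • R = 0 → R = 0)
    (hv : ∀ v : HeightOneSpectrum (𝓞 K), ((p : ℕ) : 𝓞 K) ∉ v.asIdeal →
      E.HasGoodReductionAt v ∨
        ∀ R : (E.baseChange (v.adicCompletion K)).toAffine.Point, p • R = 0 → R = 0) :
    Nat.card (IwasawaDual.endInvariants (conjSelmerAc E p κ 𝔭 ∅ γ - 1)) =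
      Nat.card (selmerAcBase E p 𝔭 ∅) :=
  (natCard_selmerAcBase_eq_of_bijective E p κ 𝔭 ∅ γ
    (controlMap_bijective_of_noPTorsion E p κ 𝔭 γ h𝔭 hv)).symm

/-- … and `H⁰(Γ, Sel_𝔭(K_∞, E[p^∞]))` is finite iff `Sel_𝔭(K, E[p^∞])` is. [cite: GreenbergLNM1716, §3 Thm. 1.2] -/
theorem finite_endInvariants_iff_finite_selmerAcBase_of_noPTorsion
    (h𝔭 : ∀ R : (E.baseChange (𝔭.adicCompletion K)).toAffine.Point, p • R = 0 → R = 0)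
    (hv : ∀ v : HeightOneSpectrum (𝓞 K), ((p : ℕ) : 𝓞 K) ∉ v.asIdeal →
      E.HasGoodReductionAt v ∨
        ∀ R : (E.baseChange (v.adicCompletion K)).toAffine.Point, p • R = 0 → R = 0) :
    Finite (IwasawaDual.endInvariants (conjSelmerAc E p κ 𝔭 ∅ γ - 1)) ↔
      Finite (selmerAcBase E p 𝔭 ∅) :=
  (finite_selmerAcBase_iff_of_bijective E p κ 𝔭 ∅ γ
    (controlMap_bijective_of_noPTorsion E p κ 𝔭 γ h𝔭 hv)).symm

end Control

/-! ## §2 At an O11 frame (the frame's CM field is imaginary quadratic, hence totally complex) -/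

section Frame

variable {W : WeierstrassCurve ℚ} [W.IsElliptic] {p : ℕ} [Fact p.Prime]
  {K : Type} [Field K] [NumberField K] {𝔭 : HeightOneSpectrum (𝓞 K)}
  {W' : WeierstrassCurve ℚ} {C : VariableChange ℚ}

/-- **Exact control at an O11 frame.** At a frame `(K, 𝔭, W', C)` of `(W, p)` (`K` the CM field,
`𝔭 ∋ p`), for EVERY `ℤ_p`-extension `κ` of `K` (in particular the anticyclotomic one) and every
topological generator `γ`: granted `E(K_𝔭)[p] = 0` and "good or no `p`-torsion" at every `v ∤ p`
(for `E = W_K`), `#H⁰(Γ, Sel_𝔭(K_∞, E[p^∞])) = #Sel_𝔭(K, E[p^∞])` — the LEFT side of the `Λ`-free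
form (R-ctrl)♭ of crux #4 IS the order of Castella's Selmer group over `K`. The objects are the
Literature ones (`Castella2018.AcSelmer.conjSelmerAc`), definitionally the sibling cell's.
[cite: GreenbergLNM1716, §3 Thm. 1.2 and p. 90] [cite: BurungaleKobayashiNakamuraOta2026, (3.16) and Thm. 6.1 (arXiv:2608.06879; shape only)] -/
theorem strictControl_frame_natCard_eq (hF : X12.O11.IsFrame W p K 𝔭 W' C)
    (κ : ZpExtension K p) (γ : absoluteGaloisGroup K) [Fact (κ.IsTopGenerator γ)]
    (h𝔭 : ∀ R : ((W.baseChange K).baseChange (𝔭.adicCompletion K)).toAffine.Point,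
      p • R = 0 → R = 0)
    (hv : ∀ v : HeightOneSpectrum (𝓞 K), ((p : ℕ) : 𝓞 K) ∉ v.asIdeal →
      (W.baseChange K).HasGoodReductionAt v ∨
        ∀ R : ((W.baseChange K).baseChange (v.adicCompletion K)).toAffine.Point,
          p • R = 0 → R = 0) :
    Nat.card (IwasawaDual.endInvariants
        (Castella2018.AcSelmer.conjSelmerAc (W.baseChange K) p κ 𝔭 ∅ γ - 1)) =
      Nat.card (selmerAcBase (W.baseChange K) p 𝔭 ∅) := by
  haveI : IsTotallyComplex K := hF.2.2.2.1.2
  haveI : (W.baseChange K).IsElliptic := by rw [baseChange]; infer_instance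
  exact natCard_endInvariants_eq_natCard_selmerAcBase_of_noPTorsion (W.baseChange K) p κ 𝔭 γ h𝔭 hv

end Frame

end Summit.BirchSwinnertonDyer.BirchSwinnertonDyer.Theorems.RamifiedSevenEllipticUnits

end
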